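import Summits.MatrixMultiplication.OmegaCensus.STPPVosperTableRatio
import Summits.MatrixMultiplication.OmegaCensus.STPP222SqSymmetry
import Summits.MatrixMultiplication.OmegaCensus.STPPDisjointPacking

/-!
# ω-census (abelian STPP census): the INVERSE-PAIR Vosper table law at `ℤ₆₁` — readings `(a,b,c)` and `(b,a,c)` of one block (kernel, general form)

HONEST FRAMING (pub-omega census; verbatim): lottery ticket; floor = certified bounds/negative ranges.
Census STRUCTURE (seat pub-omega-stpp-1 gen 29, 2026-08-28), family (b2).  A THEOREM FILTER for ℤ₆₁ patterns whose single window tables do not close;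
companion of `STPPVosperDoubleTableLaw.lean` (which pairs `(Aᵢ,Bᵢ)` with `(Aᵢ,Cᵢ)`); here both readings constrain the SAME pair `(Aᵢ, Bᵢ)`, by a ratio and by
its inverse.  Nothing here is progress on `ω`.

## Statement (`no_isSTPP_of_inverse_pair_tables`)

STPP family `(A_k,B_k,C_k)_{k<N}` with non-empty sets in `ℤ₆₁`, block `i` with another block, `a = |Aᵢ|, b = |Bᵢ|, c = |Cᵢ|`, `vol = abc`,
`z = Σ_{k≠i}|A_k||C_k|`, `L = Σ_{k≠i}|B_k||C_k|`, all of `a, b, c, z, L ≥ 2`, N18-TIGHT `z + b + vol + a + L = 63` — which is the tightness condition of BOTH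
readings `(a,b,c)` and `(b,a,c)` (the family `(−B, −A, −C)`).  Tables: `(n, m, b)` with `m = L + a − 1`, `n = vol + m`, target `J₁`, and
`(n″, m″, a)` with `m″ = z + b − 1`, `n″ = vol + m″`, target `J₂`.  SIDE CONDITION (decidable on `ℕ`): whenever `d₁ ∈ J₁`, `d₂ ∈ J₂` and
`d₁·d₂ ≡ ±1 (mod 61)`, then `d₁ ∈ {1, 60}`.  Then the family does not exist.

## Proof

`tight_ratio_val_mem` twice: `Aᵢ` an `a`-progression of step `e`, `Bᵢ` of step `e′`, `d₁ = (e/e′).val ∈ J₁`; `−Bᵢ` of step `f = ±e′`, `−Aᵢ` of step `f′ = ±e`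
(`eq_or_eq_neg_of_mutual_apFinset_subset`), `d₂ = (f/f′).val ∈ J₂`; so `(e/e′)(f/f′) = ±1`, i.e. `d₁d₂ ≡ ±1`, the side condition gives `e = ±e′`, and the word
`(s′ − s) + (t′ − t) + (γ − γ) = 0` at `(i,i,i)` breaks the TPP of block `i`.

References: A. G. Vosper, J. London Math. Soc. 31 (1956); M. B. Nathanson, *Additive Number Theory: Inverse Problems*, GTM 165, Thm 2.7; H. Cohn,
R. Kleinberg, B. Szegedy, C. Umans, FOCS 2005 (arXiv:math/0511460), Def. 5.1.
-/

open Finset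
open scoped Pointwise

namespace Summit.MatrixMultiplication.OmegaCensus.CubeNB

open Literature.Computability.AlgebraicComplexity
open Literature.Combinatorics.Additive
open Summit.MatrixMultiplication.OmegaCensus.STPPKneser

/-- **The inverse-pair Vosper table law at `ℤ₆₁` (kernel, general block).**  See the module docstring. [cite: CohnKleinbergSzegedyUmans2005, Def. 5.1]
[cite: Vosper1956, main theorem; Nathanson1996, Thm 2.7] -/
theorem no_isSTPP_of_inverse_pair_tables {N : ℕ} (A B C : Fin N → Finset (ZMod 61)) (hS : IsSTPP A B C)
    (hA : ∀ k, (A k).Nonempty) (hB : ∀ k, (B k).Nonempty) (hC : ∀ k, (C k).Nonempty)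
    (i : Fin N) (hI : ((univ : Finset (Fin N)).erase i).Nonempty)
    {a b c vol z L m n m'' n'' : ℕ} (ha : #(A i) = a) (hb : #(B i) = b) (hc : #(C i) = c) (hvol : a * b * c = vol)
    (hz : ∑ k ∈ univ.erase i, #(A k) * #(C k) = z) (hL : ∑ k ∈ univ.erase i, #(B k) * #(C k) = L)
    (h2a : 2 ≤ a) (h2b : 2 ≤ b) (h2c : 2 ≤ c) (h2z : 2 ≤ z) (h2L : 2 ≤ L) (htight : z + b + vol + a + L = 63)
    (hm : L + a = m + 1) (hn : vol + m = n) (hm'' : z + b = m'' + 1) (hn'' : vol + m'' = n'') {J₁ J₂ : Finset ℕ}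
    (htable : ∀ j < 61, ∀ t < 61, (∀ i' < m, (t + j * i') % 61 < n) →
      (∀ k < m, b ∣ (t + j * k) % 61 - #((range m).filter fun i' => (t + j * i') % 61 < (t + j * k) % 61)) → j ∈ J₁)
    (htable'' : ∀ j < 61, ∀ t < 61, (∀ i' < m'', (t + j * i') % 61 < n'') →
      (∀ k < m'', a ∣ (t + j * k) % 61 - #((range m'').filter fun i' => (t + j * i') % 61 < (t + j * k) % 61)) → j ∈ J₂)
    (hside : ∀ d₁ ∈ J₁, ∀ d₂ ∈ J₂, (d₁ * d₂ % 61 = 1 ∨ d₁ * d₂ % 61 = 60) → (d₁ = 1 ∨ d₁ = 60)) : False := by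
  have h60 : ((60 : ℕ) : ZMod 61) = -1 := by decide
  have hv1 : (1 : ZMod 61).val = 1 := rfl
  have hvm1 : (-1 : ZMod 61).val = 60 := rfl
  haveI : Fact (Nat.Prime 61) := ⟨prime_61⟩
  -- Reading (a,b,c)
  have hvolA : #(A i) * #(B i) * #(C i) = vol := by rw [ha, hb, hc, hvol]
  obtain ⟨e, e', α, β, he, he', hα, hβ, hr1⟩ := tight_ratio_val_mem A B C hS hA hB hC i hI ha hb hvolA hz hL h2a h2b h2z h2L
    htight hm hn htable
  -- Reading (b,a,c): the family (−B, −A, −C)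
  set A' : Fin N → Finset (ZMod 61) := fun t => (B t).image Neg.neg with hA'
  set B' : Fin N → Finset (ZMod 61) := fun t => (A t).image Neg.neg with hB'
  set C' : Fin N → Finset (ZMod 61) := fun t => (C t).image Neg.neg with hC'
  have hS' : IsSTPP A' B' C' := STPP222SqNeg.isSTPP_negSwap (stpp_rotate hS)
  have hcA' : ∀ t, #(A' t) = #(B t) := fun t => Finset.card_image_of_injective _ neg_injective
  have hcB' : ∀ t, #(B' t) = #(A t) := fun t => Finset.card_image_of_injective _ neg_injective
  have hcC' : ∀ t, #(C' t) = #(C t) := fun t => Finset.card_image_of_injective _ neg_injective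
  have hAne' : ∀ t, (A' t).Nonempty := fun t => (hB t).image _
  have hBne' : ∀ t, (B' t).Nonempty := fun t => (hA t).image _
  have hCne' : ∀ t, (C' t).Nonempty := fun t => (hC t).image _
  have ha' : #(A' i) = b := by rw [hcA', hb]
  have hb'' : #(B' i) = a := by rw [hcB', ha]
  have hvol' : #(A' i) * #(B' i) * #(C' i) = vol := by rw [hcA', hcB', hcC', ha, hb, hc, ← hvol]; ring
  have hzz : ∑ k ∈ univ.erase i, #(A' k) * #(C' k) = L := by simp only [hcA', hcC']; exact hL
  have hLL : ∑ k ∈ univ.erase i, #(B' k) * #(C' k) = z := by simp only [hcB', hcC']; exact hz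
  obtain ⟨f, f', α', β', hf, hf', hα', hβ', hr2⟩ := tight_ratio_val_mem A' B' C' hS' hAne' hBne' hCne' i hI ha' hb'' hvol' hzz hLL
    h2b h2a h2L h2z (by omega) hm'' hn'' htable''
  -- identify the steps up to sign: f = ±e′ (Bᵢ), f′ = ±e (Aᵢ)
  obtain ⟨a₀, rfl⟩ : ∃ a₀, a = a₀ + 1 := ⟨a - 1, by omega⟩
  obtain ⟨b₀, rfl⟩ : ∃ b₀, b = b₀ + 1 := ⟨b - 1, by omega⟩
  have h4a : (a₀ + 1) * 4 ≤ vol := by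
    rw [← hvol, mul_assoc]; exact Nat.mul_le_mul_left _ (by nlinarith)
  have h4b : (b₀ + 1) * 4 ≤ vol := by
    rw [← hvol, mul_comm (a₀ + 1) (b₀ + 1), mul_assoc]; exact Nat.mul_le_mul_left _ (by nlinarith)
  have hsize : ∀ x : ℕ, 1 ≤ x → (x + 1 - 1) * (x + 1 - 1) < (x + 1 - 1) * (x + 1 - 1) * (61 - 1) := by
    intro x hx
    have hx0 : 0 < (x + 1 - 1) * (x + 1 - 1) := Nat.mul_pos (by omega) (by omega)
    generalize (x + 1 - 1) * (x + 1 - 1) = X at hx0 ⊢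
    omega
  have hfe' : f = e' ∨ f = -e' := by
    have hneg : A' i = -(B i) := rfl
    rw [hβ, neg_apFinset, hα'] at hneg
    exact eq_or_eq_neg_of_mutual_apFinset_subset hf he' (by omega) (by omega) hneg.le hneg.symm.le (hsize b₀ (by omega))
  have hf'e : f' = e ∨ f' = -e := by
    have hneg : B' i = -(A i) := rfl
    rw [hα, neg_apFinset, hβ'] at hneg
    exact eq_or_eq_neg_of_mutual_apFinset_subset hf' he (by omega) (by omega) hneg.le hneg.symm.le (hsize a₀ (by omega))
  -- the product of the two ratios is ±1
  have hprod : (e'⁻¹ * e) * (f'⁻¹ * f) = 1 ∨ (e'⁻¹ * e) * (f'⁻¹ * f) = -1 := by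
    rcases hfe' with h1 | h1 <;> rcases hf'e with h2 | h2
    · left; rw [h1, h2]; field_simp
    · right; rw [h1, h2]; field_simp
    · right; rw [h1, h2]; field_simp
    · left; rw [h1, h2]; field_simp
  have hvalprod : (e'⁻¹ * e).val * (f'⁻¹ * f).val % 61 = 1 ∨ (e'⁻¹ * e).val * (f'⁻¹ * f).val % 61 = 60 := by
    rw [← ZMod.val_mul]
    rcases hprod with h | h
    · left; rw [h, hv1]
    · right; rw [h, hvm1]
  -- the side condition: e = ±e′
  have hpm : e = e' ∨ e = -e' := by
    have hee : e' * (e'⁻¹ * e) = e := by rw [← mul_assoc, mul_inv_cancel₀ he', one_mul]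
    rcases hside _ hr1 _ hr2 hvalprod with h1 | h60'
    · left
      have h : (((e'⁻¹ * e).val : ℕ) : ZMod 61) = ((1 : ℕ) : ZMod 61) := by rw [h1]
      rw [ZMod.natCast_zmod_val, Nat.cast_one] at h
      rw [← hee, h, mul_one]
    · right
      have h : (((e'⁻¹ * e).val : ℕ) : ZMod 61) = ((60 : ℕ) : ZMod 61) := by rw [h60']
      rw [ZMod.natCast_zmod_val, h60] at h
      rw [← hee, h, mul_neg, mul_one]
  -- the TPP of block i fails (pair Aᵢ, Bᵢ)
  obtain ⟨γ, hγ⟩ := hC i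
  have hαmem : α ∈ A i := by rw [hα]; exact mem_apFinset.2 ⟨0, by omega, by simp⟩
  have hαe : α + e ∈ A i := by rw [hα]; exact mem_apFinset.2 ⟨1, by omega, by simp⟩
  have hβmem : β ∈ B i := by rw [hβ]; exact mem_apFinset.2 ⟨0, by omega, by simp⟩
  have hβe : β + e' ∈ B i := by rw [hβ]; exact mem_apFinset.2 ⟨1, by omega, by simp⟩
  rcases hpm with h | h
  · have hrel : (α - (α + e)) + ((β + e') - β) + (γ - γ) = 0 := by rw [h]; ring
    obtain ⟨-, -, -, h4, -⟩ := hS i i i (α + e) hαe α hαmem β hβmem (β + e') hβe γ hγ γ hγ hrel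
    exact he' (by linear_combination h4.symm)
  · have hrel : ((α + e) - α) + ((β + e') - β) + (γ - γ) = 0 := by rw [h]; ring
    obtain ⟨-, -, -, h4, -⟩ := hS i i i α hαmem (α + e) hαe β hβmem (β + e') hβe γ hγ γ hγ hrel
    exact he' (by linear_combination h4.symm)

end Summit.MatrixMultiplication.OmegaCensus.CubeNB
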